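import Literature.AnabelianGeometry.AbsoluteAnabelian.AbsTopIThm26iii
import Literature.AnabelianGeometry.AbsoluteAnabelian.AbsTopIThm26iiiLocalH2Torsion
import Literature.AnabelianGeometry.AbsoluteAnabelian.AbsAnabFundamentalGroups
import Literature.AnabelianGeometry.AbsoluteAnabelian.GaloisSubextensionProofs
import Literature.AnabelianGeometry.AbsoluteAnabelian.TopFGOpenSubgroups
import Literature.NumberTheory.GaloisRepresentations.PadicCoefficientsTowerTorsion
import Literature.NumberTheory.GaloisRepresentations.CoprimeIndexZModVanishing
import Literature.NumberTheory.GaloisRepresentations.InfResTwoExact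
import Literature.NumberTheory.GaloisRepresentations.KummerTwo
import Literature.NumberTheory.GaloisRepresentations.ContinuousH1TrivialAction
import Literature.FieldTheory.Galois.FixingSubgroupAbsoluteGalois
import HarnessLib

/-!
# [AbsTopI] Thm 2.6 (iii), first clause: `θ²(Π) ⊆ Σ` — PROVED

S. Mochizuki, *Topics in Absolute Anabelian Geometry I: Generalities* (2012) [AbsTopI], Thm 2.6 (iii),
p. 22: "Let `k` be as in (ii). Then `θ²(Π) ⊆ Σ`. If, moreover, the cardinality of `θ¹(Π)` is `≥ 2`,
then `θ²(Π) = Σ`."  Proof of the first clause, p. 23: "Since `G` is of cohomological dimension `2`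
[...], and `δ²_l(G) = 0` for all `l ∈ Primes` [cf., e.g., [NSW], Theorem 7.2.6], the spectral sequence
yields an equality `δ²_l(Π) = 0` if `l ∉ Σ` [...]. By applying the analogue of this conclusion for an
arbitrary open subgroup `H ⊆ Π`, we thus obtain that `δ²_l(H) = 0` if `l ∉ Σ`, i.e., that `ε²_l(Π) = 0`
if `l ∉ Σ`; this already implies that [...] `θ²(Π) ⊆ Σ`."

PROOF-ONLY companion of abc-iut-L4-t4's `AbsTopIThm26iii.lean` (`FundamentalExtension.Thm26iii`,
`deltaInv`, `epsilonInv`, `thetaSet`): the FIRST CLAUSE of the typed predicate is proved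
(`thetaSet_two_subset_of_isProSet`) for every extension `1 → Δ → Π → G → 1` with MLF base data
(`B : E.MLFBase`), `Π` topologically finitely generated (Thm 2.6 (ii)) and `Δ` pro-`Σ` (`IsProSet`,
[AbsTopI] Def 1.1 (iii)).  The second clause ([AbsTopI] Lemma 2.7 (iii), Tate module of the Albanese)
is NOT addressed.  The spectral-sequence argument is rendered on Mathlib's continuous cochain
cohomology: for open `J ≤ Π`, prime `l ∉ Σ`, `N = Δ ∩ J` (open in `Δ`, hence pro-`Σ`) and
`J/N ≅ G_{K'}` (`K'/K` finite): `H¹ = H² = 0` for `(N, ℤ/lⁱ)` (`CoprimeIndexZModVanishing`), so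
`H²(J, ℤ/lⁱ)` is inflated from `H²(J/N, ℤ/lⁱ) ≅ H²(G_{K'}, ℤ/lⁱ)` (`InfResTwoExact`), killed by one `m`
independent of `i` (`AbsTopIThm26iiiLocalH2Torsion` = "`δ²_l(G) = 0`"); `H¹(J, ℤ/lⁱ)` is finite
(`J` tfg), so `H²_cont(J, ℚ_l) = 0` (`PadicCoefficientsTowerTorsion`), i.e. `δ²_l(J) = 0`,
`ε²_l(Π) = 0`, `l ∉ θ²(Π)`.  HONEST FRAMING: refereed, undisputed paper; classical Galois cohomology;
nothing here bears on [IUTchIII] Cor. 3.12; typed ≠ proved for the second clause.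
-/

noncomputable section

open CategoryTheory Function Topology

namespace Literature.AnabelianGeometry.AbsoluteAnabelian

open Literature.NumberTheory.GaloisRepresentations
open _root_.TopRep _root_.ContRepresentation _root_.ContinuousCohomology Field LocalWeilDatum

namespace FundamentalExtension

variable (E : FundamentalExtension.{0})

/-! ### `N = Δ ∩ J` inside an open subgroup `J ≤ Π`: pro-`Σ` -/

/-- For `Δ` pro-`Σ`, an open subgroup `J ≤ Π` and a prime `l ∉ Σ`: every open normal subgroup of
`N := Δ ∩ J` (a subgroup of `J`) has index prime to `l` (it contains the trace of an open normal
subgroup of `Δ`). [cite: MochizukiAbsTopI2012, Thm 2.6 (iii) proof p.23] -/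
theorem coprime_index_geom_subgroupOf {S : Set ℕ} (hpro : IsProSet E.geom S) {l : ℕ}
    (hl : l.Prime) (hlS : l ∉ S) {J : Subgroup E.arith} (hJ : IsOpen (J : Set E.arith))
    (U : Subgroup ↥(E.geom.subgroupOf J)) (hUo : IsOpen (U : Set ↥(E.geom.subgroupOf J))) :
    U.index.Coprime l := by
  classical
  -- `U` is the trace of an open subset `O` of `Π`
  obtain ⟨O₁, hO₁, hUO₁⟩ := isOpen_induced_iff.1 hUo
  obtain ⟨O, hO, hO₁O⟩ := isOpen_induced_iff.1 hO₁
  have hUmem : ∀ n : ↥(E.geom.subgroupOf J), n ∈ U ↔ ((n : ↥J) : E.arith) ∈ O := fun n => by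
    rw [← SetLike.mem_coe, ← hUO₁, Set.mem_preimage, ← hO₁O, Set.mem_preimage]
  -- the inclusion `N → Δ`
  let ι : ↥(E.geom.subgroupOf J) →* ↥E.geom :=
    { toFun := fun n => ⟨((n : ↥J) : E.arith), Subgroup.mem_subgroupOf.1 n.2⟩
      map_one' := rfl
      map_mul' := fun _ _ => rfl }
  -- an open normal subgroup `V` of `Δ` inside the trace of `J ∩ O`
  have hW : IsOpen {δ : ↥E.geom | (δ : E.arith) ∈ (J : Set E.arith) ∩ O} :=
    (hJ.inter hO).preimage continuous_subtype_val
  have h1 : (1 : ↥E.geom) ∈ {δ : ↥E.geom | (δ : E.arith) ∈ (J : Set E.arith) ∩ O} :=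
    ⟨J.one_mem, (hUmem 1).1 U.one_mem⟩
  haveI : CompactSpace ↥E.geom := isCompact_iff_compactSpace.1 E.isClosed_geom.isCompact
  obtain ⟨V, hV⟩ := ProfiniteGrp.exist_openNormalSubgroup_sub_open_nhds_of_one hW h1
  -- `g : N → Δ/V` has kernel inside `U`
  let g : ↥(E.geom.subgroupOf J) →* ↥E.geom ⧸ V.toSubgroup := (QuotientGroup.mk' V.toSubgroup).comp ι
  have hker : g.ker ≤ U := fun n hn => by
    rw [MonoidHom.mem_ker, MonoidHom.comp_apply, QuotientGroup.mk'_apply, QuotientGroup.eq_one_iff] at hn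
    exact (hUmem n).2 (hV hn).2
  -- `[N : U] ∣ [N : ker g] = #g(N) ∣ #(Δ/V) = [Δ : V]`
  have hdvd : U.index ∣ V.toSubgroup.index := by
    refine (Subgroup.index_dvd_of_le hker).trans ?_
    rw [Subgroup.index_ker, Subgroup.index_eq_card]
    exact Subgroup.card_subgroup_dvd_card g.range
  -- primes dividing `[Δ : V]` lie in `Σ`
  rw [Nat.coprime_comm, Nat.Prime.coprime_iff_not_dvd hl]
  intro hlU
  exact hlS (hpro.prime_dvd_index V.toSubgroup inferInstance V.isOpen' l hl (hlU.trans hdvd))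

/-! ### Finiteness of `H¹(J, ℤ/lⁱ)` for `J` topologically finitely generated -/

/-- `H¹(G, ℤ/lⁱ)` (trivial action) is finite for a compact topologically finitely generated `G`:
continuous homomorphisms `G → ℤ/lⁱ` have open kernel, and there are finitely many of them
([AbsTopI] Thm 2.6 (ii): "for every open subgroup `H ⊆ Π` [...] `δ¹_l(H)` is finite").
[cite: MochizukiAbsTopI2012, Thm 2.6 (ii) p.21] -/
theorem finite_continuousCohomology_one_zmod_of_tfg {G : Type} [Group G] [TopologicalSpace G]
    [IsTopologicalGroup G] (htfg : IsTopologicallyFinitelyGenerated G) (l i : ℕ) [NeZero l] :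
    Finite (continuousCohomology 1 (ContinuousRep.trivial G ℤ (ZMod (l ^ i))).toTopRep) := by
  classical
  haveI : NeZero (l ^ i) := ⟨pow_ne_zero i (NeZero.ne l)⟩
  haveI : Finite (Multiplicative (ZMod (l ^ i))) := inferInstanceAs (Finite (ZMod (l ^ i)))
  set X := (ContinuousRep.trivial G ℤ (ZMod (l ^ i))).toTopRep with hX
  have htriv : ∀ (g : G) (x : X), X.ρ g x = x := fun _ _ => rfl
  haveI : Finite {f : G →* Multiplicative (ZMod (l ^ i)) | IsOpen (f.ker : Set G)} :=
    (IsTopologicallyFinitelyGenerated.finite_setOf_monoidHom_isOpen_ker htfg).to_subtype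
  -- continuous crossed homomorphisms = continuous homomorphisms, determined by the underlying hom
  have hmul : ∀ (φ : contOneCocycles X) (g h : G), φ.1 (g * h) = φ.1 g + φ.1 h :=
    fun φ => contOneCocycles.apply_mul_of_trivial htriv φ
  have h1 : ∀ φ : contOneCocycles X, φ.1 1 = 0 := fun φ =>
    left_eq_add.mp (by simpa only [mul_one] using hmul φ 1 1)
  let toHom : contOneCocycles X → (G →* Multiplicative (ZMod (l ^ i))) := fun φ =>
    { toFun := fun g => Multiplicative.ofAdd (φ.1 g)
      map_one' := (by rw [h1]; rfl)
      map_mul' := fun g h => (by rw [hmul]; rfl) }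
  have htoHom : ∀ (φ : contOneCocycles X) (g : G), toHom φ g = Multiplicative.ofAdd (φ.1 g) :=
    fun _ _ => rfl
  have hker : ∀ φ : contOneCocycles X, IsOpen ((toHom φ).ker : Set G) := fun φ => by
    have h : ((toHom φ).ker : Set G) = φ.1 ⁻¹' {0} := by
      ext g
      rw [SetLike.mem_coe, MonoidHom.mem_ker, htoHom, Set.mem_preimage, Set.mem_singleton_iff]
      exact Multiplicative.ofAdd.apply_eq_iff_eq (y := (0 : ZMod (l ^ i)))
    rw [h]
    exact (isOpen_discrete _).preimage φ.1.continuous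
  let F : contOneCocycles X → {f : G →* Multiplicative (ZMod (l ^ i)) | IsOpen (f.ker : Set G)} :=
    fun φ => ⟨toHom φ, hker φ⟩
  have hF : Injective F := by
    intro φ ψ h
    apply Subtype.ext
    ext g
    have hg := congrArg (fun f : {f : G →* Multiplicative (ZMod (l ^ i)) | IsOpen (f.ker : Set G)} =>
      (f.1 g).toAdd) h
    simpa [F, htoHom] using hg
  haveI : Finite (contOneCocycles X) := Finite.of_injective F hF
  exact Finite.of_surjective _ (oneCocycleClass_surjective X)

/-! ### Uniform torsion of `H²(J, ℤ/lⁱ)` from the quotient `J/N` -/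

/-- The restriction of the trivial representation to a subgroup is the trivial representation.
[folklore] -/
private theorem trivial_restrict_subgroupIncl {G : Type} [Group G] [TopologicalSpace G]
    (N : Subgroup G) (A : Type) [AddCommGroup A] [TopologicalSpace A] :
    (ContinuousRep.trivial G ℤ A).restrict (subgroupIncl N) = ContinuousRep.trivial ↥N ℤ A :=
  ContinuousRep.ext fun _ => rfl

/-- **Inflation step.** For `Δ` pro-`Σ`, `J ≤ Π` open, `l ∉ Σ` prime and `N = Δ ∩ J`: since
`H¹(N, ℤ/lⁱ) = H²(N, ℤ/lⁱ) = 0`, every class of `H²(J, ℤ/lⁱ)` is inflated from `H²(J/N, ℤ/lⁱ)`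
(inflation–restriction in degree two); hence an integer killing `H²(J/N, (ℤ/lⁱ)^N)` kills
`H²(J, ℤ/lⁱ)`. [cite: MochizukiAbsTopI2012, Thm 2.6 (iii) proof p.23] -/
theorem nsmul_continuousCohomology_two_zmod_eq_zero_of_quotient {S : Set ℕ} (hpro : IsProSet E.geom S)
    {l : ℕ} [hl : Fact l.Prime] (hlS : l ∉ S) {J : Subgroup E.arith} (hJ : IsOpen (J : Set E.arith))
    (i : ℕ) {m : ℕ}
    (hm : ∀ w : continuousCohomology 2 (((ContinuousRep.trivial ↥J ℤ (ZMod (l ^ i))).quotientInvariants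
      (E.geom.subgroupOf J))).toTopRep, m • w = 0)
    (x : continuousCohomology 2 (ContinuousRep.trivial ↥J ℤ (ZMod (l ^ i))).toTopRep) : m • x = 0 := by
  haveI : IsClosed (J : Set E.arith) := Subgroup.isClosed_of_isOpen J hJ
  haveI : CompactSpace ↥J := isCompact_iff_compactSpace.1 (Subgroup.isClosed_of_isOpen J hJ).isCompact
  haveI : (E.geom.subgroupOf J).Normal := E.normal_geom.subgroupOf J
  have hNc : IsClosed ((E.geom.subgroupOf J : Subgroup ↥J) : Set ↥J) :=
    E.isClosed_geom.preimage continuous_subtype_val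
  haveI : IsClosed ((E.geom.subgroupOf J : Subgroup ↥J) : Set ↥J) := hNc
  haveI : CompactSpace ↥(E.geom.subgroupOf J) := isCompact_iff_compactSpace.1 hNc.isCompact
  have hcop : ∀ U : Subgroup ↥(E.geom.subgroupOf J), U.Normal →
      IsOpen (U : Set ↥(E.geom.subgroupOf J)) → U.index.Coprime l :=
    fun U _ hU => E.coprime_index_geom_subgroupOf hpro hl.out hlS hJ U hU
  have h1 : Subsingleton (continuousCohomology 1 (((ContinuousRep.trivial ↥J ℤ (ZMod (l ^ i))).restrict
      (subgroupIncl (E.geom.subgroupOf J)))).toTopRep) := by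
    rw [trivial_restrict_subgroupIncl]
    exact subsingleton_continuousCohomology_one_zmod_of_coprime_index l i hcop
  have h2 : Subsingleton (continuousCohomology 2 (((ContinuousRep.trivial ↥J ℤ (ZMod (l ^ i))).restrict
      (subgroupIncl (E.geom.subgroupOf J)))).toTopRep) := by
    rw [trivial_restrict_subgroupIncl]
    exact subsingleton_continuousCohomology_two_zmod_of_coprime_index l i hcop
  obtain ⟨w, hw⟩ := exists_inf_two_eq_of_resH_eq_zero (E.geom.subgroupOf J)
    (ContinuousRep.trivial ↥J ℤ (ZMod (l ^ i))) h1 x (Subsingleton.elim _ _)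
  rw [← hw, ← map_nsmul, hm, map_zero]

/-! ### `J/(Δ ∩ J) ≅ G_{K'}` for a finite extension `K'/K` -/

/-- A subgroup is isomorphic to its image under an isomorphism of topological groups. [folklore] -/
private theorem exists_subgroup_map_continuousMulEquiv {G H : Type} [Group G] [TopologicalSpace G]
    [Group H] [TopologicalSpace H] (e : G ≃ₜ* H) (U : Subgroup G) :
    Nonempty (↥U ≃ₜ* ↥(U.map (e : G →* H))) := by
  have hmem : ∀ x : U, e (x : G) ∈ U.map (e : G →* H) := fun x =>
    Subgroup.mem_map_of_mem (e : G →* H) x.2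
  have hmem' : ∀ y : U.map (e : G →* H), e.symm (y : H) ∈ U := fun y => by
    obtain ⟨x, hx, hxy⟩ := Subgroup.mem_map.mp y.2
    rw [show e.symm (y : H) = x by rw [← hxy]; exact e.symm_apply_apply x]; exact hx
  refine ⟨{ toFun := fun x => ⟨e (x : G), hmem x⟩
            invFun := fun y => ⟨e.symm (y : H), hmem' y⟩
            left_inv := fun x => Subtype.ext (e.symm_apply_apply (x : G))
            right_inv := fun y => Subtype.ext (e.apply_symm_apply (y : H))
            map_mul' := fun x y => Subtype.ext (map_mul e _ _)
            continuous_toFun := (e.continuous.comp continuous_subtype_val).subtype_mk _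
            continuous_invFun := (e.symm.continuous.comp continuous_subtype_val).subtype_mk _ }⟩

/-- Subgroups that are equal are isomorphic as topological groups. [folklore] -/
private theorem exists_continuousMulEquiv_of_eq {G : Type} [Group G] [TopologicalSpace G]
    {U V : Subgroup G} (h : U = V) : Nonempty (↥U ≃ₜ* ↥V) := by
  subst h; exact ⟨ContinuousMulEquiv.refl _⟩

/-- **`J/(Δ ∩ J) ≅ G_{K'}`**: for MLF base data (`G ≅ G_K`) and an open subgroup `J ≤ Π`, the
quotient `J/(Δ ∩ J) ≅ aug(J)` is an open subgroup of `G ≅ G_K`, hence the absolute Galois group of a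
finite extension `K'` of `K` ("the analogue of this conclusion for an arbitrary open subgroup
`H ⊆ Π`", [AbsTopI] p. 23: `H` is again an extension of an MLF Galois group by a pro-`Σ` group).
[cite: MochizukiAbsTopI2012, Thm 2.6 (iii) proof p.23] -/
theorem exists_quotient_continuousMulEquiv_absoluteGaloisGroup (B : E.MLFBase) {J : Subgroup E.arith}
    (hJ : IsOpen (J : Set E.arith)) :
    ∃ K' : IntermediateField B.K (AlgebraicClosure B.K), FiniteDimensional B.K K' ∧
      Nonempty (↥J ⧸ E.geom.subgroupOf J ≃ₜ* absoluteGaloisGroup ↥K') := by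
  classical
  haveI : (E.geom.subgroupOf J).Normal := E.normal_geom.subgroupOf J
  haveI : IsClosed (J : Set E.arith) := Subgroup.isClosed_of_isOpen J hJ
  haveI : CompactSpace ↥J := isCompact_iff_compactSpace.1 (Subgroup.isClosed_of_isOpen J hJ).isCompact
  -- Step 1: `J/(Δ ∩ J) ≃ₜ* aug(J)`
  let f : ↥J →* E.gal := E.aug.toMonoidHom.comp J.subtype
  have hfcont : Continuous f := E.aug.continuous.comp continuous_subtype_val
  have hker : f.ker = E.geom.subgroupOf J := by
    ext x
    rw [MonoidHom.mem_ker, Subgroup.mem_subgroupOf, mem_geom]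
    rfl
  have hrange : f.range = J.map E.aug.toMonoidHom := by
    rw [MonoidHom.range_comp, Subgroup.range_subtype]
  let e₀ : ↥J ⧸ E.geom.subgroupOf J ≃* ↥(J.map E.aug.toMonoidHom) :=
    ((QuotientGroup.quotientMulEquivOfEq hker).symm.trans (QuotientGroup.quotientKerEquivRange f)).trans
      (MulEquiv.subgroupCongr hrange)
  have he₀ : ∀ x : ↥J, ((e₀ (QuotientGroup.mk x) : ↥(J.map E.aug.toMonoidHom)) : E.gal) = f x :=
    fun _ => rfl
  have he₀cont : Continuous e₀ := by
    rw [QuotientGroup.isOpenQuotientMap_mk.isQuotientMap.continuous_iff]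
    refine continuous_induced_rng.2 ?_
    have : (Subtype.val ∘ (⇑e₀ ∘ QuotientGroup.mk)) = (f : ↥J → E.gal) := funext fun x => he₀ x
    rw [this]
    exact hfcont
  let h₀ : (↥J ⧸ E.geom.subgroupOf J) ≃ₜ ↥(J.map E.aug.toMonoidHom) :=
    Continuous.homeoOfEquivCompactToT2 (f := e₀.toEquiv) he₀cont
  let e₁ : ↥J ⧸ E.geom.subgroupOf J ≃ₜ* ↥(J.map E.aug.toMonoidHom) :=
    { e₀ with
      continuous_toFun := he₀cont
      continuous_invFun := h₀.symm.continuous }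
  -- Step 2: `aug(J)` is open in `G`; transport to `G_K`
  have hidx : (J.map E.aug.toMonoidHom).index ≠ 0 := by
    intro h0
    have hd := Subgroup.index_map_dvd (f := E.aug.toMonoidHom) E.aug_surjective (H := J)
    rw [h0, zero_dvd_iff] at hd
    haveI : Finite (E.arith ⧸ J) := Subgroup.quotient_finite_of_isOpen J hJ
    exact (Subgroup.finiteIndex_of_finite_quotient (H := J)).index_ne_zero hd
  haveI : (J.map E.aug.toMonoidHom).FiniteIndex := ⟨hidx⟩
  have hclosed : IsClosed ((J.map E.aug.toMonoidHom : Subgroup E.gal) : Set E.gal) := by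
    have : ((J.map E.aug.toMonoidHom : Subgroup E.gal) : Set E.gal) = E.aug '' (J : Set E.arith) :=
      Subgroup.coe_map _ _
    rw [this]
    exact ((Subgroup.isClosed_of_isOpen J hJ).isCompact.image E.aug.continuous).isClosed
  have hopen₁ : IsOpen ((J.map E.aug.toMonoidHom : Subgroup E.gal) : Set E.gal) :=
    Subgroup.isOpen_of_isClosed_of_finiteIndex _ hclosed
  set H₂ : Subgroup (absoluteGaloisGroup B.K) :=
    (J.map E.aug.toMonoidHom).map (B.galIso : E.gal →* absoluteGaloisGroup B.K) with hH₂
  obtain ⟨e₂⟩ := exists_subgroup_map_continuousMulEquiv B.galIso (J.map E.aug.toMonoidHom)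
  have hopen₂ : IsOpen (H₂ : Set (absoluteGaloisGroup B.K)) := by
    rw [hH₂, Subgroup.coe_map]
    exact B.galIso.toHomeomorph.isOpenMap _ hopen₁
  -- Step 3: an open subgroup of `G_K` is `G_{K'}`
  obtain ⟨K', hfin, hK'⟩ := exists_galFixing_eq_of_isOpen H₂ hopen₂
  obtain ⟨e₃⟩ := exists_continuousMulEquiv_of_eq hK'.symm
  -- `galFixing K K' = K'.fixingSubgroup` read through the identity `toAlgEquiv`
  have e₄ : ↥(galFixing B.K K') ≃ₜ* ↥K'.fixingSubgroup :=
    { toFun := fun x => ⟨absoluteGaloisGroup.toAlgEquiv B.K x.1, x.2⟩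
      invFun := fun y => ⟨(absoluteGaloisGroup.toAlgEquiv B.K).symm y.1, by
        have h := y.2
        change (absoluteGaloisGroup.toAlgEquiv B.K) ((absoluteGaloisGroup.toAlgEquiv B.K).symm y.1) ∈ _
        rwa [MulEquiv.apply_symm_apply]⟩
      left_inv := fun x => Subtype.ext ((absoluteGaloisGroup.toAlgEquiv B.K).symm_apply_apply x.1)
      right_inv := fun y => Subtype.ext ((absoluteGaloisGroup.toAlgEquiv B.K).apply_symm_apply y.1)
      map_mul' := fun x y => Subtype.ext (map_mul _ _ _)
      continuous_toFun := continuous_induced_rng.2 continuous_subtype_val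
      continuous_invFun := continuous_induced_rng.2 continuous_subtype_val }
  haveI : Algebra.IsAlgebraic B.K (AlgebraicClosure B.K) := inferInstance
  exact ⟨K', hfin, ⟨e₁.trans (e₂.trans (e₃.trans (e₄.trans
    (Literature.FieldTheory.Galois.fixingSubgroupEquivAbsoluteGaloisGroup K'))))⟩⟩

/-! ### Transport of uniform torsion along an isomorphism of topological groups -/

/-- `ContinuousCohomology.map` along the identity with identity coefficients is the identity. [folklore] -/
private theorem continuousCohomology_map_eq_id' {k : Type*} [Ring k] [TopologicalSpace k]
    {H : Type} [Group H] [TopologicalSpace H] [IsTopologicalGroup H]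
    {X : TopRep k H} (θ : H →ₜ* H) (F : TopRep.res (θ : H →* H) X ⟶ X)
    (hθ : θ = ContinuousMonoidHom.id H) (hF : ∀ x : X, F.hom x = x) (q : ℕ) :
    ContinuousCohomology.map θ F q = 𝟙 _ := by
  subst hθ
  have : F = 𝟙 X :=
    TopRep.hom_ext (ContIntertwiningMap.ext (ContinuousLinearMap.ext fun x => hF x))
  rw [this]
  exact ContinuousCohomology.map_id X q

/-- If `X` (over `G`) and `Y` (over `H`) correspond under `e : G ≃ₜ* H` (`ψ ∘ φ = id`), an integer
killing `Hⁿ(H, Y)` kills `Hⁿ(G, X)`. [folklore] -/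
private theorem nsmul_continuousCohomology_eq_zero_of_continuousMulEquiv {G H : Type} [Group G]
    [TopologicalSpace G] [IsTopologicalGroup G] [Group H] [TopologicalSpace H] [IsTopologicalGroup H]
    (e : G ≃ₜ* H) {X : TopRep.{0} ℤ G} {Y : TopRep.{0} ℤ H}
    (φ : TopRep.res ((e.symm : H →ₜ* G) : H →* G) X ⟶ Y)
    (ψ : TopRep.res ((e : G →ₜ* H) : G →* H) Y ⟶ X)
    (hψφ : ∀ x : X, ψ.hom (φ.hom x) = x) (n : ℕ) {m : ℕ}
    (hm : ∀ y : continuousCohomology n Y, m • y = 0) (x : continuousCohomology n X) : m • x = 0 := by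
  have hcomp : ContinuousCohomology.map (e.symm : H →ₜ* G) φ n ≫
      ContinuousCohomology.map (e : G →ₜ* H) ψ n = 𝟙 _ := by
    rw [← ContinuousCohomology.map_comp]
    exact continuousCohomology_map_eq_id' _ _ (by ext g; simp) (fun x => hψφ x) n
  have hx : (ContinuousCohomology.map (e : G →ₜ* H) ψ n).hom
      ((ContinuousCohomology.map (e.symm : H →ₜ* G) φ n).hom x) = x := by
    have h := congr_arg (fun f => f.hom x) hcomp
    simpa using h
  rw [← hx, ← map_nsmul, hm, map_zero]

/-! ### `δ²_l(J) = 0` for open `J ≤ Π` and `l ∉ Σ`; the first clause of Thm 2.6 (iii) -/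

/-- **`δ²_l(J) = 0`** for every open subgroup `J ≤ Π` and every prime `l ∉ Σ`, when `G ≅ G_K` (`K` an
MLF), `Π` is topologically finitely generated and `Δ` is pro-`Σ` ([AbsTopI] Thm 2.6 (iii), proof p. 23:
"we thus obtain that `δ²_l(H) = 0` if `l ∉ Σ`"). [cite: MochizukiAbsTopI2012, Thm 2.6 (iii) proof p.23] -/
theorem deltaInv_two_eq_zero_of_isProSet (B : E.MLFBase) {S : Set ℕ}
    (htfg : IsTopologicallyFinitelyGenerated E.arith) (hpro : IsProSet E.geom S) {l : ℕ}
    [hl : Fact l.Prime] (hlS : l ∉ S) {J : Subgroup E.arith} (hJ : IsOpen (J : Set E.arith)) :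
    deltaInv ↥J 2 l = 0 := by
  classical
  haveI : IsClosed (J : Set E.arith) := Subgroup.isClosed_of_isOpen J hJ
  haveI : CompactSpace ↥J := isCompact_iff_compactSpace.1 (Subgroup.isClosed_of_isOpen J hJ).isCompact
  haveI : (E.geom.subgroupOf J).Normal := E.normal_geom.subgroupOf J
  -- `J/(Δ ∩ J) ≅ G_{K'}`, `K'/K/ℚ_p` finite
  obtain ⟨K', hfinK', ⟨e⟩⟩ := E.exists_quotient_continuousMulEquiv_absoluteGaloisGroup B hJ
  haveI := hfinK'
  haveI : FiniteDimensional ℚ_[B.p] ↥K' := FiniteDimensional.trans ℚ_[B.p] B.K ↥K'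
  obtain ⟨m, hm0, hm⟩ := exists_nsmul_continuousCohomology_two_zmod_eq_zero B.p ↥K' l
  -- uniform torsion of `H²(J, ℤ/lⁱ)`
  have hmJ : ∀ (i : ℕ) (x : continuousCohomology 2 (zmodRep ↥J l i)), m • x = 0 := by
    intro i x
    refine E.nsmul_continuousCohomology_two_zmod_eq_zero_of_quotient hpro hlS hJ i (fun w => ?_) x
    let ρ := ContinuousRep.trivial ↥J ℤ (ZMod (l ^ i))
    let τ := ρ.quotientInvariants (E.geom.subgroupOf J)
    let Y := (ContinuousRep.trivial (absoluteGaloisGroup ↥K') ℤ (ZMod (l ^ i))).toTopRep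
    have hτ : ∀ (q : ↥J ⧸ E.geom.subgroupOf J) (v : ρ.invariantsOf (E.geom.subgroupOf J)),
        ((τ q v : ρ.invariantsOf (E.geom.subgroupOf J)) : ZMod (l ^ i)) = v := by
      intro q v
      obtain ⟨σ, rfl⟩ := QuotientGroup.mk_surjective q
      exact ContinuousRep.quotientInvariants_apply_coe (E.geom.subgroupOf J) ρ σ v
    let φ : TopRep.res ((e.symm : absoluteGaloisGroup ↥K' →ₜ* (↥J ⧸ E.geom.subgroupOf J)) :
        absoluteGaloisGroup ↥K' →* (↥J ⧸ E.geom.subgroupOf J)) τ.toTopRep ⟶ Y :=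
      TopRep.ofHom
        ⟨{ toLinearMap := (ρ.invariantsOf (E.geom.subgroupOf J)).subtype
           cont := continuous_subtype_val }, fun g => by
          refine ContinuousLinearMap.ext fun v => ?_
          exact hτ _ v⟩
    let ψ : TopRep.res ((e : (↥J ⧸ E.geom.subgroupOf J) →ₜ* absoluteGaloisGroup ↥K') :
        (↥J ⧸ E.geom.subgroupOf J) →* absoluteGaloisGroup ↥K') Y ⟶ τ.toTopRep :=
      TopRep.ofHom
        ⟨{ toFun := fun a => ⟨a, fun _ => rfl⟩
           map_add' := fun _ _ => rfl
           map_smul' := fun _ _ => rfl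
           cont := continuous_of_discreteTopology }, fun g => by
          refine ContinuousLinearMap.ext fun a => Subtype.ext ?_
          exact (hτ _ _).symm⟩
    exact nsmul_continuousCohomology_eq_zero_of_continuousMulEquiv e φ ψ
      (fun v => Subtype.ext rfl) 2 (hm i) w
  -- finiteness of `H¹(J, ℤ/lⁱ)` and the passage to `ℚ_l`
  have htfgJ : IsTopologicallyFinitelyGenerated ↥J := htfg.subgroup_isOpen J hJ
  haveI : NeZero l := ⟨hl.out.ne_zero⟩
  have hfin : ∀ i, Finite (continuousCohomology 1 (zmodRep ↥J l i)) := fun i =>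
    finite_continuousCohomology_one_zmod_of_tfg htfgJ l i
  haveI := subsingleton_continuousCohomology_two_padic_of_forall_zmod (G := ↥J) l hfin hm0 hmJ
  unfold deltaInv
  rw [rank_subsingleton', map_zero]

/-- **[AbsTopI] Thm 2.6 (iii), first clause: `θ²(Π) ⊆ Σ`** — for an extension `1 → Δ → Π → G → 1`
with `G ≅ G_K`, `K` an MLF (`B : E.MLFBase`), `Π` topologically finitely generated (Thm 2.6 (ii)) and
`Δ` pro-`Σ`: the first conjunct of the typed `E.Thm26iii S`.  ("this already implies that if
`l ∉ Σ`, then `l ∉ θ²(Π)`, i.e., that `θ²(Π) ⊆ Σ`", p. 23.)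
[cite: MochizukiAbsTopI2012, Thm 2.6 (iii) p.22] -/
theorem thetaSet_two_subset_of_isProSet (B : E.MLFBase) {S : Set ℕ}
    (htfg : IsTopologicallyFinitelyGenerated E.arith) (hpro : IsProSet E.geom S) :
    thetaSet E.arith 2 ⊆ {l ∈ S | l.Prime} := by
  intro l hl
  obtain ⟨hlp, hle⟩ := hl
  refine ⟨?_, hlp⟩
  by_contra hlS
  haveI : Fact l.Prime := ⟨hlp⟩
  have h0 : epsilonInv E.arith 2 l = 0 := by
    refine nonpos_iff_eq_zero.mp ?_
    unfold epsilonInv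
    refine iSup₂_le fun J hJ => ?_
    rw [E.deltaInv_two_eq_zero_of_isProSet B htfg hpro hlS hJ]
  have h1 : ((3 - 2 : ℕ) : ℕ∞) ≤ 0 := h0 ▸ hle
  norm_num at h1

end FundamentalExtension

end Literature.AnabelianGeometry.AbsoluteAnabelian

end
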